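import Literature.AlgebraicGeometry.ModuliOfAbelianVarieties.SiegelPrincipalLevelMultiplier
import HarnessLib

/-!
# `GSp = 𝔾_m ⋉ Sp`: uniqueness of the multiplier, the section `u ↦ diag(1, u·1)`, and `GSp(R) = D(R^×)·Sp(R)`

Topic `Literature/AlgebraicGeometry/ModuliOfAbelianVarieties`, namespace
`Literature.AlgebraicGeometry.ModuliOfAbelianVarieties`.  THEOREMS ONLY (no `def`, no named fact, no
instance, no `sorry`); Mathlib matrix algebra over an arbitrary commutative ring `R`, on top of the tree's
★ `IsMultiplier` / `similitudeGroupOfForm` / `symplecticGroupOfForm` (`SymplecticSimilitudeGroup.lean`) and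
★ `typeFormOver_eq_fromBlocks` (`SiegelPrincipalLevelMultiplier.lean`).

[Milne ISV] §6 p. 67: «`GSp(ψ)(k) = {g ∈ GL(V)(k) | ψ(gu, gv) = ν(g)ψ(u, v) some ν(g) ∈ k^×}` …
`Sp(ψ) = Ker(ν)` … `ν` is a homomorphism `GSp(ψ) → 𝔾_m`»; [Deligne 1971] 1.6 p. 128 / 4.16 p. 150
(`GSp = CSp_{2g}`, the multiplier character).  The tree types the multiplier RELATIONALLY
(`IsMultiplier E g ν : gᵀ E g = ν • E`, no function `ν`); this file supplies the bookkeeping that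
makes the relational multiplier behave as the printed homomorphism with kernel `Sp` and a section:

* §1 UNIQUENESS — `IsMultiplier.eq_of_isRegular`: if one Gram entry `E i j` is a regular element, a
  similitude has at most one multiplier (`ν • E = μ • E ⇒ ν = μ`); for the type-`δ` form the entry
  `(inl i, inr i) = δ i` serves (`IsMultiplier.eq_of_typeFormOver`, any `R` in which `δ i` is regular,
  e.g. every `ℚ`-algebra when `0 < δ i`: `isRegular_natCast_of_algebraRat`).
* §2 KERNEL — `Sp(E) = {ν = 1}`: `IsMultiplier.mem_symplecticGroupOfForm_iff`, and the FIBRES of `ν`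
  are `Sp(E)`-cosets: `IsMultiplier.inv_mul_mem_symplecticGroupOfForm` (same multiplier ⇒ `g⁻¹h ∈ Sp`),
  with `Sp ⊴ GSp` (`conj_mem_symplecticGroupOfForm`, `normal_symplecticGroupOfForm_subgroupOf`).
* §3 SECTION — for a block-antidiagonal form `E = [[0, B], [C, 0]]` (e.g. `E_δ`, ★ `typeFormOver_eq_fromBlocks`)
  and every unit `u`, the block matrix `diag(1, u·1)` is an invertible similitude with multiplier `u`
  (`exists_generalLinearGroup_coe_eq_fromBlocks_one_smul`, `isMultiplier_fromBlocks_of_coe_eq`,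
  `exists_isMultiplier_typeFormOver`): `ν : GSp_δ(R) → R^×` is ONTO for every `R`.
* §4 DECOMPOSITION — `GSp(E)(R) = D(R^×) · Sp(E)(R)`: every similitude is `diag(1, ν·1) · s` with `s`
  symplectic (`IsMultiplier.exists_eq_fromBlocks_mul_symplectic`, `mem_similitudeGroupOfForm_typeFormOver_iff`).

Generic in `R`; the two finite-adelic special cases already in the tree (★ `SiegelPrincipalLevelMultiplier`
(β) inside `K_δ(N)`, the private `isMultiplier_fromBlocks_one_scalar` of ★ `SiegelCanonicalModelFineModuli`)
are instances.  Consumer (cell hodgecm-mathlib, road #60, piece index of the Siegel Shimura set): the map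
`GSp_δ(ℚ)₊\GSp_δ(𝔸_f)/K →ν ℚ_{>0}\𝔸_f^×/ν(K)` is well defined by §1, onto by §3, and its fibres are
`Sp_δ`-double cosets by §2/§4.

## References
* [Milne2005ShimuraVarieties] J. S. Milne, *Introduction to Shimura varieties* (2005), §6 p. 67.
* [Deligne1971TravauxShimura] P. Deligne, *Travaux de Shimura*, Sém. Bourbaki 389 (1971), 1.6 p. 128, 4.16 p. 150.
* [GenestierNgo2020] A. Genestier, B. C. Ngô, *Lectures on Shimura varieties*, §1.2, §2.1.
-/

set_option autoImplicit false

namespace Literature.AlgebraicGeometry.ModuliOfAbelianVarieties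

open Matrix

variable {R : Type*} [CommRing R] {n : Type*} [Fintype n] [DecidableEq n]

/-! ### §1. Uniqueness of the multiplier -/

/-- Two multipliers of the same similitude give the same multiple of the Gram matrix:
`ν • E = gᵀ E g = μ • E`. [cite: Milne2005ShimuraVarieties, §6 p. 67] -/
theorem IsMultiplier.smul_eq_smul {E : Matrix n n R} {g : GL n R} {ν μ : Rˣ} (hν : IsMultiplier E g ν)
    (hμ : IsMultiplier E g μ) : (ν : R) • E = (μ : R) • E :=
  hν.symm.trans hμ

/-- **Uniqueness of the multiplier.**  If some Gram entry `E i j` is a regular element of `R` (e.g. a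
unit, or any non-zero entry in a domain), a similitude `g` of `E` has at most one multiplier:
`gᵀ E g = ν • E = μ • E` forces `ν = μ`.  This is what lets the printed multiplier CHARACTER
`ν : GSp(ψ) → 𝔾_m` be read off the tree's relational `IsMultiplier`.
[cite: Milne2005ShimuraVarieties, §6 p. 67 («ν(g)»)] -/
theorem IsMultiplier.eq_of_isRegular {E : Matrix n n R} {g : GL n R} {ν μ : Rˣ} (hν : IsMultiplier E g ν)
    (hμ : IsMultiplier E g μ) {i j : n} (hE : IsRegular (E i j)) : ν = μ := by
  have h := congrFun (congrFun (hν.smul_eq_smul hμ) i) j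
  simp only [Matrix.smul_apply, smul_eq_mul] at h
  exact Units.ext (hE.right h)

/-- Uniqueness of the multiplier when some Gram entry is a unit. [cite: Milne2005ShimuraVarieties, §6 p. 67] -/
theorem IsMultiplier.eq_of_isUnit {E : Matrix n n R} {g : GL n R} {ν μ : Rˣ} (hν : IsMultiplier E g ν)
    (hμ : IsMultiplier E g μ) {i j : n} (hE : IsUnit (E i j)) : ν = μ :=
  hν.eq_of_isRegular hμ hE.isRegular

section TypeForm

variable {g : ℕ} (δ : Fin g → ℕ)

/-- The `(inl i, inr i)` entry of `E_δ` over `R` is `δ i`. [cite: GenestierNgo2020, §1.2] -/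
theorem typeFormOver_apply_inl_inr (R : Type*) [CommRing R] (i : Fin g) :
    typeFormOver δ R (Sum.inl i) (Sum.inr i) = (δ i : R) := by
  rw [typeFormOver_apply, typeForm, Matrix.fromBlocks_apply₁₂, Matrix.diagonal_apply_eq, Int.cast_natCast]

/-- **Uniqueness of the multiplier for `GSp_δ(R)`** whenever some `δ i` is a regular element of `R`
(any `ℚ`-algebra when `0 < δ i`; any domain of characteristic `0`). [cite: Milne2005ShimuraVarieties, §6 p. 67] -/
theorem IsMultiplier.eq_of_typeFormOver {R : Type*} [CommRing R] {G : GL (Fin g ⊕ Fin g) R} {ν μ : Rˣ}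
    (hν : IsMultiplier (typeFormOver δ R) G ν) (hμ : IsMultiplier (typeFormOver δ R) G μ) (i : Fin g)
    (hδ : IsRegular ((δ i : ℕ) : R)) : ν = μ :=
  hν.eq_of_isRegular hμ (i := Sum.inl i) (j := Sum.inr i) (by rwa [typeFormOver_apply_inl_inr])

/-- In a `ℚ`-algebra a positive natural number is a unit, hence regular. [cite: GenestierNgo2020, §1.2] -/
theorem isUnit_natCast_of_algebraRat (R : Type*) [CommRing R] [Algebra ℚ R] {m : ℕ} (hm : 0 < m) :
    IsUnit ((m : ℕ) : R) := by
  have h : IsUnit ((m : ℚ)) := (Nat.cast_ne_zero.2 hm.ne').isUnit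
  simpa only [map_natCast] using h.map (algebraMap ℚ R)

/-- In a `ℚ`-algebra a positive natural number is a regular element. [cite: GenestierNgo2020, §1.2] -/
theorem isRegular_natCast_of_algebraRat (R : Type*) [CommRing R] [Algebra ℚ R] {m : ℕ} (hm : 0 < m) :
    IsRegular ((m : ℕ) : R) :=
  (isUnit_natCast_of_algebraRat R hm).isRegular

/-- **Uniqueness of the multiplier for `GSp_δ` over any `ℚ`-algebra** (`𝔸_{ℚ,f}`, `ℝ`, `ℂ`, …) as soon
as some `δ i` is positive. [cite: Milne2005ShimuraVarieties, §6 p. 67] [cite: Deligne1971TravauxShimura, 4.16 p. 150] -/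
theorem IsMultiplier.eq_of_typeFormOver_of_algebraRat {R : Type*} [CommRing R] [Algebra ℚ R]
    {G : GL (Fin g ⊕ Fin g) R} {ν μ : Rˣ} (hν : IsMultiplier (typeFormOver δ R) G ν)
    (hμ : IsMultiplier (typeFormOver δ R) G μ) (i : Fin g) (hδ : 0 < δ i) : ν = μ :=
  hν.eq_of_typeFormOver δ hμ i (isRegular_natCast_of_algebraRat R hδ)

end TypeForm

/-! ### §2. Kernel: `Sp(E) = {ν = 1}`, fibres of `ν` are `Sp(E)`-cosets, `Sp ⊴ GSp` -/

/-- `Sp(E)` is the multiplier-`1` locus (definitional). [cite: Milne2005ShimuraVarieties, §6 p. 67 («Sp(ψ) = Ker(ν)»)] -/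
theorem mem_symplecticGroupOfForm_iff_isMultiplier_one {E : Matrix n n R} {g : GL n R} :
    g ∈ symplecticGroupOfForm E ↔ IsMultiplier E g 1 :=
  Iff.rfl

/-- A similitude with multiplier `ν` is symplectic iff `ν = 1` (given a regular Gram entry).
[cite: Milne2005ShimuraVarieties, §6 p. 67 («Sp(ψ) = Ker(ν)»)] -/
theorem IsMultiplier.mem_symplecticGroupOfForm_iff {E : Matrix n n R} {g : GL n R} {ν : Rˣ}
    (hν : IsMultiplier E g ν) {i j : n} (hE : IsRegular (E i j)) :
    g ∈ symplecticGroupOfForm E ↔ ν = 1 := by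
  refine ⟨fun hg ↦ hν.eq_of_isRegular hg hE, ?_⟩
  rintro rfl
  exact hν

/-- **Fibres of `ν` are `Sp`-cosets**: two similitudes with the same multiplier differ by a symplectic
element on the left, `g⁻¹ h ∈ Sp(E)` (no regularity needed). [cite: Milne2005ShimuraVarieties, §6 p. 67] -/
theorem IsMultiplier.inv_mul_mem_symplecticGroupOfForm {E : Matrix n n R} {g h : GL n R} {ν : Rˣ}
    (hg : IsMultiplier E g ν) (hh : IsMultiplier E h ν) : g⁻¹ * h ∈ symplecticGroupOfForm E := by
  have := hg.inv.mul hh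
  rwa [inv_mul_cancel] at this

/-- Same multiplier ⇒ `g h⁻¹ ∈ Sp(E)`. [cite: Milne2005ShimuraVarieties, §6 p. 67] -/
theorem IsMultiplier.mul_inv_mem_symplecticGroupOfForm {E : Matrix n n R} {g h : GL n R} {ν : Rˣ}
    (hg : IsMultiplier E g ν) (hh : IsMultiplier E h ν) : g * h⁻¹ ∈ symplecticGroupOfForm E := by
  have := hg.mul hh.inv
  rwa [mul_inv_cancel] at this

/-- Conversely, `g · s` has the multiplier of `g` for `s` symplectic. [cite: Milne2005ShimuraVarieties, §6 p. 67] -/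
theorem IsMultiplier.mul_of_mem_symplecticGroupOfForm {E : Matrix n n R} {g s : GL n R} {ν : Rˣ}
    (hg : IsMultiplier E g ν) (hs : s ∈ symplecticGroupOfForm E) : IsMultiplier E (g * s) ν := by
  have := hg.mul hs
  rwa [mul_one] at this

/-- `s · g` has the multiplier of `g` for `s` symplectic. [cite: Milne2005ShimuraVarieties, §6 p. 67] -/
theorem IsMultiplier.mul_of_mem_symplecticGroupOfForm_left {E : Matrix n n R} {g s : GL n R} {ν : Rˣ}
    (hg : IsMultiplier E g ν) (hs : s ∈ symplecticGroupOfForm E) : IsMultiplier E (s * g) ν := by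
  have := IsMultiplier.mul hs hg
  rwa [one_mul] at this

/-- **`Sp(E)` is normalised by every similitude**: `g s g⁻¹ ∈ Sp(E)` (multiplier `ν · 1 · ν⁻¹ = 1`).
[cite: Milne2005ShimuraVarieties, §6 p. 67] -/
theorem IsMultiplier.conj_mem_symplecticGroupOfForm {E : Matrix n n R} {g s : GL n R} {ν : Rˣ}
    (hg : IsMultiplier E g ν) (hs : s ∈ symplecticGroupOfForm E) : g * s * g⁻¹ ∈ symplecticGroupOfForm E := by
  have := (hg.mul_of_mem_symplecticGroupOfForm hs).mul hg.inv
  rwa [mul_inv_cancel] at this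

/-- **`Sp(E) ⊴ GSp(E)`**: the symplectic group is a normal subgroup of the similitude group.
[cite: Milne2005ShimuraVarieties, §6 p. 67 («Sp(ψ) = Ker(ν)»)] -/
theorem normal_symplecticGroupOfForm_subgroupOf (E : Matrix n n R) :
    ((symplecticGroupOfForm E).subgroupOf (similitudeGroupOfForm E)).Normal := by
  refine ⟨fun s hs g ↦ ?_⟩
  obtain ⟨ν, hν⟩ := g.2
  rw [Subgroup.mem_subgroupOf] at hs ⊢
  simpa only [Subgroup.coe_mul, Subgroup.coe_inv] using hν.conj_mem_symplecticGroupOfForm hs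

/-! ### §3. The section `u ↦ diag(1, u·1)` for a block-antidiagonal form -/

section Section

variable {m : Type*} [Fintype m] [DecidableEq m]

/-- The block matrix `diag(1, u·1)` is invertible with inverse `diag(1, u⁻¹·1)`: an element of
`GL_{m ⊕ m}(R)` with these entries (and these inverse entries) exists.  (Scalar case of the diagonal-family
form ★ `exists_generalLinearGroup_coe_eq_fromBlocks` of `SymplecticFormTransport.lean`, with the inverse recorded.)
[cite: Deligne1971TravauxShimura, Exemple 4.16 p. 150] -/
theorem exists_generalLinearGroup_coe_eq_fromBlocks_one_smul (u : Rˣ) :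
    ∃ d : GL (m ⊕ m) R, (d : Matrix (m ⊕ m) (m ⊕ m) R) = fromBlocks 1 0 0 ((u : R) • (1 : Matrix m m R)) ∧
      ((d⁻¹ : GL (m ⊕ m) R) : Matrix (m ⊕ m) (m ⊕ m) R) =
        fromBlocks 1 0 0 (((u⁻¹ : Rˣ) : R) • (1 : Matrix m m R)) := by
  let d : GL (m ⊕ m) R :=
    { val := fromBlocks 1 0 0 ((u : R) • (1 : Matrix m m R))
      inv := fromBlocks 1 0 0 (((u⁻¹ : Rˣ) : R) • (1 : Matrix m m R))
      val_inv := by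
        rw [Matrix.fromBlocks_multiply]
        simp [smul_smul, Matrix.fromBlocks_one]
      inv_val := by
        rw [Matrix.fromBlocks_multiply]
        simp [smul_smul, Matrix.fromBlocks_one] }
  exact ⟨d, rfl, rfl⟩

/-- **`diag(1, u·1)` is a similitude with multiplier `u`** of every block-antidiagonal form
`E = [[0, B], [C, 0]]`: `diag(1,u)ᵀ E diag(1,u) = [[0, uB], [uC, 0]] = u • E`.
[cite: Milne2005ShimuraVarieties, §6 p. 67] [cite: Deligne1971TravauxShimura, Exemple 4.16 p. 150] -/
theorem isMultiplier_fromBlocks_of_coe_eq (B C : Matrix m m R) {d : GL (m ⊕ m) R} {u : Rˣ}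
    (hd : (d : Matrix (m ⊕ m) (m ⊕ m) R) = fromBlocks 1 0 0 ((u : R) • (1 : Matrix m m R))) :
    IsMultiplier (fromBlocks 0 B C 0) d u := by
  rw [isMultiplier_iff, hd, Matrix.fromBlocks_transpose, Matrix.transpose_one, Matrix.transpose_zero,
    Matrix.transpose_smul, Matrix.transpose_one, Matrix.fromBlocks_multiply, Matrix.fromBlocks_multiply,
    Matrix.fromBlocks_smul]
  simp

/-- **Every unit is a multiplier** of a block-antidiagonal form: `ν : GSp(E)(R) → R^×` is onto, with the
explicit section `u ↦ diag(1, u·1)`. [cite: Milne2005ShimuraVarieties, §6 p. 67] -/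
theorem exists_isMultiplier_fromBlocks (B C : Matrix m m R) (u : Rˣ) :
    ∃ d : GL (m ⊕ m) R, (d : Matrix (m ⊕ m) (m ⊕ m) R) = fromBlocks 1 0 0 ((u : R) • (1 : Matrix m m R)) ∧
      IsMultiplier (fromBlocks 0 B C 0) d u := by
  obtain ⟨d, hd, -⟩ := exists_generalLinearGroup_coe_eq_fromBlocks_one_smul (m := m) u
  exact ⟨d, hd, isMultiplier_fromBlocks_of_coe_eq B C hd⟩

variable {g : ℕ} (δ : Fin g → ℕ)

/-- **Every unit of `R` is a multiplier of `GSp_δ(R)`**, with section `u ↦ diag(1_g, u·1_g)`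
(`E_δ = [[0, D], [-D, 0]]`, ★ `typeFormOver_eq_fromBlocks`). [cite: Deligne1971TravauxShimura, Exemple 4.16 p. 150]
[cite: Milne2005ShimuraVarieties, §6 p. 67] -/
theorem exists_isMultiplier_typeFormOver (R : Type) [CommRing R] (u : Rˣ) :
    ∃ d : GL (Fin g ⊕ Fin g) R,
      (d : Matrix (Fin g ⊕ Fin g) (Fin g ⊕ Fin g) R) = fromBlocks 1 0 0 ((u : R) • (1 : Matrix (Fin g) (Fin g) R)) ∧
        IsMultiplier (typeFormOver δ R) d u := by
  rw [typeFormOver_eq_fromBlocks]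
  exact exists_isMultiplier_fromBlocks _ _ u

/-- The section lands in `GSp_δ(R)`: for every unit `u` there is `d ∈ GSp_δ(R)` with multiplier `u` and
entries `diag(1_g, u·1_g)`. [cite: Deligne1971TravauxShimura, Exemple 4.16 p. 150] -/
theorem exists_mem_similitudeGroupOfForm_typeFormOver_isMultiplier (R : Type) [CommRing R] (u : Rˣ) :
    ∃ d ∈ similitudeGroupOfForm (typeFormOver δ R), IsMultiplier (typeFormOver δ R) d u ∧
      (d : Matrix (Fin g ⊕ Fin g) (Fin g ⊕ Fin g) R) = fromBlocks 1 0 0 ((u : R) • (1 : Matrix (Fin g) (Fin g) R)) := by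
  obtain ⟨d, hd, hmult⟩ := exists_isMultiplier_typeFormOver δ R u
  exact ⟨d, ⟨u, hmult⟩, hmult, hd⟩

end Section

/-! ### §4. Decomposition `GSp(E)(R) = D(R^×) · Sp(E)(R)` -/

section Decomposition

variable {m : Type*} [Fintype m] [DecidableEq m]

/-- **`GSp = D · Sp`** for a block-antidiagonal form: a similitude `g` with multiplier `ν` is
`diag(1, ν·1) · s` with `s` symplectic (`s = diag(1, ν·1)⁻¹ g` has multiplier `ν⁻¹ν = 1`).
[cite: Milne2005ShimuraVarieties, §6 p. 67] [cite: Deligne1971TravauxShimura, 1.6 p. 128] -/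
theorem IsMultiplier.exists_eq_fromBlocks_mul_symplectic (B C : Matrix m m R) {G : GL (m ⊕ m) R} {ν : Rˣ}
    (hG : IsMultiplier (fromBlocks 0 B C 0) G ν) :
    ∃ d s : GL (m ⊕ m) R, (d : Matrix (m ⊕ m) (m ⊕ m) R) = fromBlocks 1 0 0 ((ν : R) • (1 : Matrix m m R)) ∧
      IsMultiplier (fromBlocks 0 B C 0) d ν ∧ s ∈ symplecticGroupOfForm (fromBlocks 0 B C 0) ∧ G = d * s := by
  obtain ⟨d, hd, hmult⟩ := exists_isMultiplier_fromBlocks B C ν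
  exact ⟨d, d⁻¹ * G, hd, hmult, hmult.inv_mul_mem_symplecticGroupOfForm hG, by rw [mul_inv_cancel_left]⟩

variable {g : ℕ} (δ : Fin g → ℕ)

/-- **`GSp_δ(R) = D(R^×) · Sp_δ(R)`**: every `G ∈ GSp_δ(R)` with multiplier `ν` factors as
`diag(1_g, ν·1_g) · s`, `s ∈ Sp_δ(R)`. [cite: Milne2005ShimuraVarieties, §6 p. 67] [cite: Deligne1971TravauxShimura, 1.6 p. 128] -/
theorem IsMultiplier.exists_eq_fromBlocks_mul_symplectic_typeFormOver (R : Type) [CommRing R]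
    {G : GL (Fin g ⊕ Fin g) R} {ν : Rˣ} (hG : IsMultiplier (typeFormOver δ R) G ν) :
    ∃ d s : GL (Fin g ⊕ Fin g) R,
      (d : Matrix (Fin g ⊕ Fin g) (Fin g ⊕ Fin g) R) = fromBlocks 1 0 0 ((ν : R) • (1 : Matrix (Fin g) (Fin g) R)) ∧
        IsMultiplier (typeFormOver δ R) d ν ∧ s ∈ symplecticGroupOfForm (typeFormOver δ R) ∧ G = d * s := by
  rw [typeFormOver_eq_fromBlocks] at hG ⊢
  exact hG.exists_eq_fromBlocks_mul_symplectic _ _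

/-- **Membership in `GSp_δ(R)`** ⇔ `G = diag(1_g, u·1_g) · s` for a unit `u` and a symplectic `s`.
[cite: Milne2005ShimuraVarieties, §6 p. 67] -/
theorem mem_similitudeGroupOfForm_typeFormOver_iff (R : Type) [CommRing R] {G : GL (Fin g ⊕ Fin g) R} :
    G ∈ similitudeGroupOfForm (typeFormOver δ R) ↔
      ∃ (u : Rˣ) (d s : GL (Fin g ⊕ Fin g) R),
        (d : Matrix (Fin g ⊕ Fin g) (Fin g ⊕ Fin g) R) = fromBlocks 1 0 0 ((u : R) • (1 : Matrix (Fin g) (Fin g) R)) ∧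
          s ∈ symplecticGroupOfForm (typeFormOver δ R) ∧ G = d * s := by
  constructor
  · rintro ⟨u, hu⟩
    obtain ⟨d, s, hd, -, hs, hG⟩ := hu.exists_eq_fromBlocks_mul_symplectic_typeFormOver δ R
    exact ⟨u, d, s, hd, hs, hG⟩
  · rintro ⟨u, d, s, hd, hs, rfl⟩
    have hd' : IsMultiplier (typeFormOver δ R) d u := by
      rw [typeFormOver_eq_fromBlocks]
      exact isMultiplier_fromBlocks_of_coe_eq _ _ hd
    exact ⟨u, hd'.mul_of_mem_symplecticGroupOfForm hs⟩

/-- **Fibres of `ν` on `GSp_δ(R)` are exactly the `Sp_δ(R)`-cosets** (regular `δ i`): for similitudes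
`G, H` with multipliers `ν, μ`, `G⁻¹ H ∈ Sp_δ(R) ↔ ν = μ`. [cite: Milne2005ShimuraVarieties, §6 p. 67 («Sp(ψ) = Ker(ν)»)] -/
theorem IsMultiplier.inv_mul_mem_symplecticGroupOfForm_iff (R : Type*) [CommRing R]
    {G H : GL (Fin g ⊕ Fin g) R} {ν μ : Rˣ} (hG : IsMultiplier (typeFormOver δ R) G ν)
    (hH : IsMultiplier (typeFormOver δ R) H μ) (i : Fin g) (hδ : IsRegular ((δ i : ℕ) : R)) :
    G⁻¹ * H ∈ symplecticGroupOfForm (typeFormOver δ R) ↔ ν = μ := by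
  refine ⟨fun h ↦ ?_, ?_⟩
  · have h1 : IsMultiplier (typeFormOver δ R) (G * (G⁻¹ * H)) ν := hG.mul_of_mem_symplecticGroupOfForm h
    rw [mul_inv_cancel_left] at h1
    exact h1.eq_of_typeFormOver δ hH i hδ
  · rintro rfl
    exact hG.inv_mul_mem_symplecticGroupOfForm hH

end Decomposition

end Literature.AlgebraicGeometry.ModuliOfAbelianVarieties
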